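import Literature.Probability.Percolation.MarkedLoopRotation
import HarnessLib

/-!
# Class-only weights: at `k ≥ 5` marks the tripod law forces a constant («CLASS-ONLY-ALL»)

Khristoforov–Smirnov [KhS21, §2 Definition 3 / Lemma 4] weigh the THREE link classes of a three-marked loop configuration by `τ^j`
and obtain a discretely holomorphic parafermionic observable; in the tree's vocabulary (`MarkedLoopHolomorphy.lean`) the weight
`j ↦ τ^j` obeys the TRIPOD LAW at `k = 3` corners (`tripodLaw_tau_pow`) and the law gives holomorphicity on every marked domain
(`holomorphicW_of_tripodLaw`, any `k`). This file settles what a weight depending on the CLASS `j` ALONE (not on the link pattern) can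
be at MORE marks — the statements are the lane's (Khristoforov–Smirnov treat three disorders):

* ★ `tripodPicture_consecutive` — for `2l+1 ≥ 3` corners the explicit picture `(0, 1, 2; rainbow on 3 … 2l)`; ★ `tripodPicture_gapped` —
  for `2l+1 ≥ 5` the picture `(0, 3, 4; {1~2} + rainbow on 5 … 2l)` (`arcRainbow`, `cor`; all fields by `omega` on corner values);
  rotated copies by `TripodPicture.map` / `isCyc_rot_pow` (`MarkedLoopRotation.lean`).
* ★ `classOnly_rel_consecutive` / `classOnly_rel_gapped` — a class-only tripod-law weight satisfies `c_n + τ c_{n+1} + τ² c_{n+2} = 0` and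
  `c_n + τ c_{n+3} + τ² c_{n+4} = 0` along the rotation orbit of the corner `0`.
* `const_of_consecutive_of_gapped` — the algebra: the first differences are geometric of ratio `τ`, so `c_{n+3} = c_n`, and the gapped
  relation leaves `τ²·(c_{n+1} − c_n) = 0`; ★★★ `tripodLaw_classOnly_iff (hl : 2 ≤ l)` — **AT `2l+1 ≥ 5` MARKS A CLASS-ONLY
  WEIGHT OBEYS THE TRIPOD LAW IFF IT IS CONSTANT**; `tripodLaw_const`, `holomorphicW_const` (constants obey, any `k`);
  `holomorphicW_classOnly_of_tripodLaw`.
* the role of `3 ∣ k`: `const_of_consecutive_of_not_three_dvd`, ★★ `classOnly_const_of_consecutive` — when `3 ∤ 2l+1` the CONSECUTIVE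
  pictures alone force the constant (`τ^{2l+1} ≠ 1`); ★ `consecutive_rel_tau_pow_of_three_dvd` — when `3 ∣ 2l+1` the weight `τ^j` obeys
  every consecutive relation (so for `k = 9, 15, …` the gapped picture is what excludes it; for `k = 3` there is no other picture and
  ★ `tripodLaw_classOnly_three_iff`: the class-only law at three marks IS the one relation `c₀ + τ c₁ + τ² c₂ = 0`).

So Khristoforov–Smirnov's recipe «weight the class `j` by `τ^j`» is special to three disorders in the strongest sense: at every larger odd
number of disorders no non-constant function of the class alone obeys the tripod law (pattern-dependent solutions abound: the solution
space has dimension the Catalan number `C_{l+1}`, `MarkedLoopTripodBasis.finrank_solW_eq_card_ncMatching`; `k = 5`: the five rotated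
fans, `MarkedLoopTripodBasisFive.lean`). The converse «holomorphic on every `k`-marked domain ⇒ tripod law» is in the tree at `k = 5`
(`MarkedLoopNecessityFive.lean`) and is not claimed here for larger `k`.

References: [KhS21] M. Khristoforov, S. Smirnov, *Percolation and O(1) loop model*, arXiv:2111.15612v1 (2021), §1.2 (p. 2: loop
representation, link patterns, cyclic indexing `u_{n±m} := u_n`), §2 Definition 3 (p. 4: `τ := exp(2πi/3)`, `F = Σ τ^j H_j`) and
Lemma 4 with its proof and Fig. 3 (p. 4: «each triple contributes zero»); [BR06] B. Bollobás, O. Riordan, *Percolation*, CUP 2006,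
Ch. 7 (context only). The statements are the lane's; locators point at the notions being generalised.

Tree: `MarkedLoopHolomorphy.lean` (`TripodPicture`, `TripodLaw`, `withPair`, `mem_withPair`, `CcwTriple`, `CcwQuad`, `HolomorphicW`,
`holomorphicW_of_tripodLaw`, `tripodLaw_tau_pow`), `MarkedLoopRotation.lean` (`rot`, `val_rot_pow`, `isCyc_rot_pow`, `relMap`,
`TripodPicture.map`). Tactics: `omega` on corner values (`Fin.ext_iff`, `Fin.lt_def`), `linear_combination` with `1 + τ + τ² = 0` / `τ³ = 1`,
`IsPrimitiveRoot.pow_eq_one_iff_dvd`, `decide` only for the three-corner triple table.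
-/

namespace Literature.Probability.Percolation.MarkedLoops

open Literature.Probability.Percolation.FivePoint (tau)

variable {l : ℕ}

/-- `1 + τ + τ² = 0`. [folklore] -/
private theorem tau_sum_all : 1 + tau + tau ^ 2 = 0 := by
  have hprim : IsPrimitiveRoot tau 3 := by
    have h := Complex.isPrimitiveRoot_exp 3 (by norm_num)
    unfold tau
    convert h using 2
    push_cast
    ring
  have h := hprim.geom_sum_eq_zero (by norm_num : 1 < 3)
  simp only [Finset.sum_range_succ, Finset.sum_range_zero, pow_zero, pow_one, zero_add] at h
  linear_combination h

/-- `τ³ = 1`. [folklore] -/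
private theorem tau_cube_all : tau ^ 3 = 1 := by linear_combination (tau - 1) * tau_sum_all

/-- `τ ≠ 0`. [folklore] -/
private theorem tau_ne_zero_all : tau ≠ 0 := fun h => by
  have := tau_cube_all
  rw [h] at this
  norm_num at this

/-! ### Two explicit tripod pictures for every odd number of corners -/
section Pictures

/-- the corner `i` of `Fin (2l+1)` (a bounds-carrying abbreviation). [cite: KhristoforovSmirnov2021, §1.2 (arXiv v1 p. 2: cyclic indexing)] -/
abbrev cor (l i : ℕ) (h : i < 2 * l + 1) : Fin (2 * l + 1) := ⟨i, h⟩

/-- **the arc rainbow**: the pairs `(a, b)` of corners with `m ≤ a, b` and `a + b = s` (a nested = non-crossing matching of an arc).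
[cite: KhristoforovSmirnov2021, §1.2 (arXiv v1 p. 2: link patterns)] -/
def arcRainbow (l m s : ℕ) : Finset (Fin (2 * l + 1) × Fin (2 * l + 1)) :=
  Finset.univ.filter fun ab => m ≤ ab.1.val ∧ m ≤ ab.2.val ∧ ab.1.val + ab.2.val = s

/-- membership in the arc rainbow. [cite: KhristoforovSmirnov2021, §1.2 (arXiv v1 p. 2)] -/
theorem mem_arcRainbow {m s : ℕ} {a b : Fin (2 * l + 1)} :
    (a, b) ∈ arcRainbow l m s ↔ m ≤ a.val ∧ m ≤ b.val ∧ a.val + b.val = s := by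
  unfold arcRainbow
  rw [Finset.mem_filter]
  exact ⟨fun h => h.2, fun h => ⟨Finset.mem_univ _, h⟩⟩

/-- ★ **the CONSECUTIVE tripod picture** `(0, 1, 2; rainbow on 3 … 2l)` of `2l+1 ≥ 3` corners.
[cite: KhristoforovSmirnov2021, §2 Lemma 4, proof and Fig. 3 (arXiv v1 p. 4)] -/
theorem tripodPicture_consecutive (hl : 1 ≤ l) :
    TripodPicture (cor l 0 (by omega)) (cor l 1 (by omega)) (cor l 2 (by omega)) (arcRainbow l 3 (2 * l + 3)) where
  ccw := Or.inl ⟨by rw [Fin.lt_def]; norm_num, by rw [Fin.lt_def]; norm_num⟩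
  symm a b hab := by rw [mem_arcRainbow] at hab ⊢; omega
  irrefl a haa := by rw [mem_arcRainbow] at haa; omega
  off a b hab := by
    rw [mem_arcRainbow] at hab
    refine ⟨fun e => ?_, fun e => ?_, fun e => ?_⟩ <;> rw [Fin.ext_iff] at e <;> simp only at e <;> omega
  perfect a h0 h1 h2 := by
    rw [Ne, Fin.ext_iff] at h0 h1 h2
    simp only at h0 h1 h2
    have ha := a.isLt
    refine ⟨⟨2 * l + 3 - a.val, by omega⟩, ?_, fun b hb => ?_⟩
    · show (a, (⟨2 * l + 3 - a.val, _⟩ : Fin (2 * l + 1))) ∈ arcRainbow l 3 (2 * l + 3)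
      rw [mem_arcRainbow]; simp only; omega
    · have hb' : (a, b) ∈ arcRainbow l 3 (2 * l + 3) := hb
      rw [mem_arcRainbow] at hb'
      rw [Fin.ext_iff]; simp only; omega
  planar x y z w hxz hyw := by
    rw [mem_arcRainbow] at hyw
    simp only [mem_withPair, Fin.ext_iff] at hxz
    rw [mem_arcRainbow] at hxz
    unfold CcwQuad
    simp only [Fin.lt_def]
    omega

/-- ★ **the GAPPED tripod picture** `(0, 3, 4; {1~2} + rainbow on 5 … 2l)` of `2l+1 ≥ 5` corners.
[cite: KhristoforovSmirnov2021, §2 Lemma 4, proof and Fig. 3 (arXiv v1 p. 4)] -/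
theorem tripodPicture_gapped (hl : 2 ≤ l) :
    TripodPicture (cor l 0 (by omega)) (cor l 3 (by omega)) (cor l 4 (by omega))
      (withPair (arcRainbow l 5 (2 * l + 5)) (cor l 1 (by omega)) (cor l 2 (by omega))) where
  ccw := Or.inl ⟨by rw [Fin.lt_def]; norm_num, by rw [Fin.lt_def]; norm_num⟩
  symm a b hab := by
    simp only [mem_withPair, Fin.ext_iff, mem_arcRainbow] at hab ⊢; omega
  irrefl a haa := by simp only [mem_withPair, Fin.ext_iff, mem_arcRainbow] at haa; omega
  off a b hab := by
    simp only [mem_withPair, Fin.ext_iff, mem_arcRainbow] at hab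
    refine ⟨fun e => ?_, fun e => ?_, fun e => ?_⟩ <;> rw [Fin.ext_iff] at e <;> simp only at e <;> omega
  perfect a h0 h3 h4 := by
    rw [Ne, Fin.ext_iff] at h0 h3 h4
    simp only at h0 h3 h4
    have ha := a.isLt
    refine ⟨⟨if a.val = 1 then 2 else if a.val = 2 then 1 else 2 * l + 5 - a.val, by split_ifs <;> omega⟩, ?_, fun b hb => ?_⟩
    · show (a, (⟨if a.val = 1 then 2 else if a.val = 2 then 1 else 2 * l + 5 - a.val, _⟩ : Fin (2 * l + 1))) ∈
        withPair (arcRainbow l 5 (2 * l + 5)) (cor l 1 (by omega)) (cor l 2 (by omega))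
      simp only [mem_withPair, Fin.ext_iff, mem_arcRainbow]
      split_ifs <;> omega
    · have hb' : (a, b) ∈ withPair (arcRainbow l 5 (2 * l + 5)) (cor l 1 (by omega)) (cor l 2 (by omega)) := hb
      simp only [mem_withPair, Fin.ext_iff, mem_arcRainbow] at hb'
      rw [Fin.ext_iff]; simp only
      split_ifs <;> omega
  planar x y z w hxz hyw := by
    simp only [mem_withPair, Fin.ext_iff, mem_arcRainbow] at hxz hyw
    unfold CcwQuad
    simp only [Fin.lt_def]
    omega

end Pictures

/-! ### The relations of a class-only weight and their consequence -/
section ClassOnly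

/-- the value of `rot^n` on the corner `0`: the corner `n mod (2l+1)`. [cite: KhristoforovSmirnov2021, §1.2 (arXiv v1 p. 2: cyclic indexing)] -/
theorem val_rot_pow_cor_zero (n : ℕ) : ((rot (2 * l + 1) ^ n) (cor l 0 (by omega))).val = n % (2 * l + 1) := by
  rw [val_rot_pow]; simp

/-- `rot^n` of the corner `i` is `rot^(n+i)` of the corner `0`. [cite: KhristoforovSmirnov2021, §1.2 (arXiv v1 p. 2: cyclic indexing)] -/
theorem rot_pow_cor (n i : ℕ) (h : i < 2 * l + 1) :
    (rot (2 * l + 1) ^ n) (cor l i h) = (rot (2 * l + 1) ^ (n + i)) (cor l 0 (by omega)) := by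
  rw [Fin.ext_iff, val_rot_pow, val_rot_pow]
  simp only
  rw [Nat.zero_add, Nat.add_comm]

/-- ★ **the CONSECUTIVE relations of a class-only tripod-law weight**: `c_n + τ c_{n+1} + τ² c_{n+2} = 0` along the rotation orbit.
[cite: KhristoforovSmirnov2021, §2 Lemma 4, proof and Fig. 3 (arXiv v1 p. 4)] -/
theorem classOnly_rel_consecutive (hl : 1 ≤ l) {c : Fin (2 * l + 1) → ℂ}
    (h : TripodLaw (fun (j : Fin (2 * l + 1)) (_ : Finset (Fin (2 * l + 1) × Fin (2 * l + 1))) => c j)) (n : ℕ) :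
    c ((rot (2 * l + 1) ^ n) (cor l 0 (by omega))) + tau * c ((rot (2 * l + 1) ^ (n + 1)) (cor l 0 (by omega))) +
      tau ^ 2 * c ((rot (2 * l + 1) ^ (n + 2)) (cor l 0 (by omega))) = 0 := by
  have hP := (tripodPicture_consecutive hl).map (isCyc_rot_pow (nm := 2 * l + 1) n)
  have := h _ _ _ _ hP
  simp only at this
  rwa [rot_pow_cor n 1, rot_pow_cor n 2] at this

/-- ★ **the GAPPED relations**: `c_n + τ c_{n+3} + τ² c_{n+4} = 0` (`2l+1 ≥ 5`).
[cite: KhristoforovSmirnov2021, §2 Lemma 4, proof and Fig. 3 (arXiv v1 p. 4)] -/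
theorem classOnly_rel_gapped (hl : 2 ≤ l) {c : Fin (2 * l + 1) → ℂ}
    (h : TripodLaw (fun (j : Fin (2 * l + 1)) (_ : Finset (Fin (2 * l + 1) × Fin (2 * l + 1))) => c j)) (n : ℕ) :
    c ((rot (2 * l + 1) ^ n) (cor l 0 (by omega))) + tau * c ((rot (2 * l + 1) ^ (n + 3)) (cor l 0 (by omega))) +
      tau ^ 2 * c ((rot (2 * l + 1) ^ (n + 4)) (cor l 0 (by omega))) = 0 := by
  have hP := (tripodPicture_gapped hl).map (isCyc_rot_pow (nm := 2 * l + 1) n)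
  have := h _ _ _ _ hP
  simp only at this
  rwa [rot_pow_cor n 3, rot_pow_cor n 4] at this

/-- the algebra: a sequence with `g_n + τ g_{n+1} + τ² g_{n+2} = 0` and `g_n + τ g_{n+3} + τ² g_{n+4} = 0` for all `n` is constant
(`τ = exp(2πi/3)`). [cite: KhristoforovSmirnov2021, §2 Definition 3 (arXiv v1 p. 4: «We set τ := exp(2πi/3)»)] -/
theorem const_of_consecutive_of_gapped {g : ℕ → ℂ} (h1 : ∀ n, g n + tau * g (n + 1) + tau ^ 2 * g (n + 2) = 0)
    (h2 : ∀ n, g n + tau * g (n + 3) + tau ^ 2 * g (n + 4) = 0) (n : ℕ) : g n = g 0 := by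
  -- the first differences are geometric with ratio `τ` …
  have hgeo : ∀ n, g (n + 2) - g (n + 1) = tau * (g (n + 1) - g n) := fun n => by
    linear_combination tau * h1 n - g (n + 2) * tau_cube_all - g (n + 1) * tau_sum_all
  -- … hence `g (n+3) = g n` and `g (n+4) = g (n+1)` …
  have h3 : ∀ n, g (n + 3) = g n := fun n => by
    have e1 := hgeo n
    have e2 := hgeo (n + 1)
    linear_combination e2 + (1 + tau) * e1 + (g (n + 1) - g n) * tau_sum_all
  -- … and the gapped relation kills the difference.
  have hdiff : ∀ n, g (n + 1) = g n := fun n => by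
    have e := h2 n
    rw [h3 n, show n + 4 = (n + 1) + 3 from by ring, h3 (n + 1)] at e
    have : tau ^ 2 * (g (n + 1) - g n) = 0 := by linear_combination e - g n * tau_sum_all
    have ht : tau ^ 2 ≠ 0 := pow_ne_zero _ tau_ne_zero_all
    have := (mul_eq_zero.1 this).resolve_left ht
    linear_combination this
  induction n with
  | zero => rfl
  | succ n ih => rw [hdiff n, ih]

/-- the algebra of the CONSECUTIVE relations alone, for a `k`-periodic sequence with `3 ∤ k`: the first differences are geometric with
ratio `τ` and return to themselves after `k` steps, so `(τ^k − 1)·d = 0` and `τ^k ≠ 1`.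
[cite: KhristoforovSmirnov2021, §2 Definition 3 (arXiv v1 p. 4: «We set τ := exp(2πi/3)»)] -/
theorem const_of_consecutive_of_not_three_dvd {k : ℕ} (hk : ¬ 3 ∣ k) {g : ℕ → ℂ} (hper : ∀ n, g (n + k) = g n)
    (h1 : ∀ n, g n + tau * g (n + 1) + tau ^ 2 * g (n + 2) = 0) (n : ℕ) : g n = g 0 := by
  have hgeo : ∀ n, g (n + 2) - g (n + 1) = tau * (g (n + 1) - g n) := fun n => by
    linear_combination tau * h1 n - g (n + 2) * tau_cube_all - g (n + 1) * tau_sum_all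
  have hiter : ∀ m n, g (n + m + 1) - g (n + m) = tau ^ m * (g (n + 1) - g n) := by
    intro m
    induction m with
    | zero => intro n; simp
    | succ m ih =>
      intro n
      have e := hgeo (n + m)
      rw [show n + (m + 1) + 1 = n + m + 2 from by ring, show n + (m + 1) = n + m + 1 from by ring, e, ih n]
      ring
  have hk3 : tau ^ k ≠ 1 := by
    intro h
    have hprim : IsPrimitiveRoot tau 3 := by
      have h := Complex.isPrimitiveRoot_exp 3 (by norm_num)
      unfold tau
      convert h using 2
      push_cast
      ring
    exact hk ((hprim.pow_eq_one_iff_dvd k).1 h)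
  have hdiff : ∀ n, g (n + 1) = g n := fun n => by
    have e := hiter k n
    rw [hper, show n + k + 1 = (n + 1) + k from by ring, hper] at e
    have : (tau ^ k - 1) * (g (n + 1) - g n) = 0 := by linear_combination -e
    rcases mul_eq_zero.1 this with h | h
    · exact absurd (sub_eq_zero.1 h) hk3
    · exact (sub_eq_zero.1 h)
  induction n with
  | zero => rfl
  | succ n ih => rw [hdiff n, ih]

/-- ★★ **WHEN `3 ∤ k` THE CONSECUTIVE PICTURES ALONE FORCE A CONSTANT** (`k = 2l+1 ≥ 3`; so at `k = 5, 7, 11, 13, …` the gapped picture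
is not needed). [cite: KhristoforovSmirnov2021, §2 Lemma 4, proof and Fig. 3 (arXiv v1 p. 4)] -/
theorem classOnly_const_of_consecutive (hl : 1 ≤ l) (hk : ¬ 3 ∣ 2 * l + 1) {c : Fin (2 * l + 1) → ℂ}
    (h : ∀ n : ℕ, c ((rot (2 * l + 1) ^ n) (cor l 0 (by omega))) + tau * c ((rot (2 * l + 1) ^ (n + 1)) (cor l 0 (by omega))) +
      tau ^ 2 * c ((rot (2 * l + 1) ^ (n + 2)) (cor l 0 (by omega))) = 0) (j : Fin (2 * l + 1)) : c j = c 0 := by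
  have hper : ∀ n, c ((rot (2 * l + 1) ^ (n + (2 * l + 1))) (cor l 0 (by omega))) = c ((rot (2 * l + 1) ^ n) (cor l 0 (by omega))) := by
    intro n
    congr 1
    rw [Fin.ext_iff, val_rot_pow_cor_zero, val_rot_pow_cor_zero, Nat.add_mod_right]
  have key := const_of_consecutive_of_not_three_dvd hk (g := fun n => c ((rot (2 * l + 1) ^ n) (cor l 0 (by omega)))) hper h j.val
  simp only [pow_zero, Equiv.Perm.coe_one, id_eq] at key
  have hj : (rot (2 * l + 1) ^ j.val) (cor l 0 (by omega)) = j := by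
    rw [Fin.ext_iff, val_rot_pow_cor_zero]
    exact Nat.mod_eq_of_lt j.isLt
  rw [hj] at key
  rw [key]
  exact congrArg c (Fin.ext (by simp))

/-- ★ … whereas **WHEN `3 ∣ k` THE WEIGHT `j ↦ τ^j` OBEYS EVERY CONSECUTIVE RELATION** without being constant — it is the gapped picture
that excludes it for `k ≥ 9` (`k = 3`: it is Khristoforov–Smirnov's solution, `tripodLaw_tau_pow`).
[cite: KhristoforovSmirnov2021, §2 Definition 3 and Lemma 4 (arXiv v1 p. 4)] -/
theorem consecutive_rel_tau_pow_of_three_dvd (hk : 3 ∣ 2 * l + 1) (n : ℕ) :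
    tau ^ ((rot (2 * l + 1) ^ n) (cor l 0 (by omega))).val + tau * tau ^ ((rot (2 * l + 1) ^ (n + 1)) (cor l 0 (by omega))).val +
      tau ^ 2 * tau ^ ((rot (2 * l + 1) ^ (n + 2)) (cor l 0 (by omega))).val = 0 := by
  have hprim : IsPrimitiveRoot tau 3 := by
    have h := Complex.isPrimitiveRoot_exp 3 (by norm_num)
    unfold tau
    convert h using 2
    push_cast
    ring
  -- `τ^(m mod k) = τ^m` when `3 ∣ k`
  have hk1 : tau ^ (2 * l + 1) = 1 := (hprim.pow_eq_one_iff_dvd _).2 hk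
  have hmod : ∀ m : ℕ, tau ^ (m % (2 * l + 1)) = tau ^ m := fun m => by
    conv_rhs => rw [← Nat.mod_add_div m (2 * l + 1), pow_add, pow_mul, hk1, one_pow, mul_one]
  rw [val_rot_pow_cor_zero, val_rot_pow_cor_zero, val_rot_pow_cor_zero, hmod, hmod, hmod]
  linear_combination tau ^ n * tau_sum_all + tau ^ (n + 1) * tau_cube_all

/-- ★ constants obey the tripod law (any number of corners).
[cite: KhristoforovSmirnov2021, §2 Lemma 4 (arXiv v1 p. 4: «each triple contributes zero»)] -/
theorem tripodLaw_const {nm : ℕ} (a : ℂ) : TripodLaw (fun (_ : Fin nm) (_ : Finset (Fin nm × Fin nm)) => a) := by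
  intro α β γ L₀ _
  linear_combination a * tau_sum_all

/-- ★ … hence are discretely holomorphic on every marked domain. [cite: KhristoforovSmirnov2021, §2 Lemma 4 eq. (3) (arXiv v1 p. 4)] -/
theorem holomorphicW_const {nm : ℕ} (a : ℂ) (D : TriMarkedDomain nm) :
    HolomorphicW D (fun (_ : Fin nm) (_ : Finset (Fin nm × Fin nm)) => a) :=
  holomorphicW_of_tripodLaw D (tripodLaw_const a)

/-- ★★★ **CLASS-ONLY TRIPOD-LAW WEIGHTS AT `k ≥ 5` MARKS ARE THE CONSTANTS**: for `2l+1 ≥ 5` corners, a weight depending on the class `j`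
alone obeys the tripod law iff it is constant. (At three corners Khristoforov–Smirnov's `j ↦ τ^j` obeys it — `tripodLaw_tau_pow`; the
consecutive relations alone would still allow `τ^j` whenever `3 ∣ 2l+1`, and the gapped picture excludes it.)
[cite: KhristoforovSmirnov2021, §2 Definition 3 and Lemma 4 (arXiv v1 p. 4)] -/
theorem tripodLaw_classOnly_iff (hl : 2 ≤ l) (c : Fin (2 * l + 1) → ℂ) :
    TripodLaw (fun (j : Fin (2 * l + 1)) (_ : Finset (Fin (2 * l + 1) × Fin (2 * l + 1))) => c j) ↔
      ∀ j : Fin (2 * l + 1), c j = c 0 := by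
  constructor
  · intro h j
    have key := const_of_consecutive_of_gapped (g := fun n => c ((rot (2 * l + 1) ^ n) (cor l 0 (by omega))))
      (classOnly_rel_consecutive (by omega) h) (classOnly_rel_gapped hl h) j.val
    simp only [pow_zero, Equiv.Perm.coe_one, id_eq] at key
    have hj : (rot (2 * l + 1) ^ j.val) (cor l 0 (by omega)) = j := by
      rw [Fin.ext_iff, val_rot_pow_cor_zero]
      exact Nat.mod_eq_of_lt j.isLt
    rw [hj] at key
    rw [key]
    exact congrArg c (Fin.ext (by simp))
  · intro h
    have hc : c = fun _ => c 0 := funext h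
    rw [hc]
    exact tripodLaw_const (c 0)

/-- ★★ … so a class-only weight at `k ≥ 5` marks that obeys the law is holomorphic on every marked domain only by being constant; stated
as: law ⇒ (holomorphic everywhere, trivially) and law ⇔ constant. [cite: KhristoforovSmirnov2021, §2 Lemma 4 (arXiv v1 p. 4)] -/
theorem holomorphicW_classOnly_of_tripodLaw (hl : 2 ≤ l) {c : Fin (2 * l + 1) → ℂ}
    (h : TripodLaw (fun (j : Fin (2 * l + 1)) (_ : Finset (Fin (2 * l + 1) × Fin (2 * l + 1))) => c j))
    (D : TriMarkedDomain (2 * l + 1)) (j : Fin (2 * l + 1)) :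
    HolomorphicW D (fun (j : Fin (2 * l + 1)) (_ : Finset (Fin (2 * l + 1) × Fin (2 * l + 1))) => c j) ∧ c j = c 0 :=
  ⟨holomorphicW_of_tripodLaw D h, (tripodLaw_classOnly_iff hl c).1 h j⟩

end ClassOnly

/-! ### Three corners: the one relation -/
section Three

/-- ★ **AT THREE MARKS the class-only tripod law is ONE relation** `c₀ + τ c₁ + τ² c₂ = 0` (solved by the constants AND by `τ^j`).
[cite: KhristoforovSmirnov2021, §2 Definition 3 and Lemma 4 (arXiv v1 p. 4)] -/
theorem tripodLaw_classOnly_three_iff (c : Fin 3 → ℂ) :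
    TripodLaw (fun (j : Fin 3) (_ : Finset (Fin 3 × Fin 3)) => c j) ↔ c 0 + tau * c 1 + tau ^ 2 * c 2 = 0 := by
  constructor
  · intro h
    have := classOnly_rel_consecutive (l := 1) le_rfl h 0
    have e0 : (rot (2 * 1 + 1) ^ 0) (cor 1 0 (by omega)) = (0 : Fin 3) := by rw [Fin.ext_iff, val_rot_pow]; decide
    have e1 : (rot (2 * 1 + 1) ^ (0 + 1)) (cor 1 0 (by omega)) = (1 : Fin 3) := by rw [Fin.ext_iff, val_rot_pow]; decide
    have e2 : (rot (2 * 1 + 1) ^ (0 + 2)) (cor 1 0 (by omega)) = (2 : Fin 3) := by rw [Fin.ext_iff, val_rot_pow]; decide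
    rw [e0, e1, e2] at this
    exact this
  · intro h α β γ L₀ hP
    have hccw : ∀ α β γ : Fin 3, CcwTriple α β γ →
        (α = 0 ∧ β = 1 ∧ γ = 2) ∨ (α = 1 ∧ β = 2 ∧ γ = 0) ∨ (α = 2 ∧ β = 0 ∧ γ = 1) := by
      unfold CcwTriple; decide
    simp only
    rcases hccw α β γ hP.ccw with ⟨rfl, rfl, rfl⟩ | ⟨rfl, rfl, rfl⟩ | ⟨rfl, rfl, rfl⟩
    · exact h
    · linear_combination tau ^ 2 * h - (c 1 + tau * c 2) * tau_cube_all
    · linear_combination tau * h - c 2 * tau_cube_all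

end Three

end Literature.Probability.Percolation.MarkedLoops
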